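import Mathlib.Data.ZMod.Basic
import Mathlib.Data.Fintype.BigOperators
import Mathlib.Algebra.Order.Field.Basic
import Literature.Computability.Cryptography.UniformModQ
import Literature.Computability.Complexity.BoolEncodings
import Literature.Computability.FineGrained.SATBruteForceCount
import HarnessLib

/-!
# Reading near-uniform elements of `ℤ_q` off a uniform coin string, chunk by chunk

Topic `Computability/Cryptography`. A randomised reduction that needs independent uniform
elements of `ℤ_q` (e.g. Regev 2009, §4: "choose a vector `t ∈ ℤ_pⁿ` uniformly at random",
"`l ∈ ℤ_p` chosen uniformly at random") but only has uniform coin BITS reads them off disjoint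
`K`-bit chunks of its coin string, each chunk taken as a binary number and reduced mod `q`
(`chunk`, `chunkVal`; Naor–Reingold 2004, Construction 4.1 for the same device). This file proves
the one-sided domination estimate that lets the analysis pretend the elements are exactly uniform:

* `sum_castVec_div_le`: for a family of positions `Pos` and any `[0,1]`-valued statistic `F` of
  the family of residues, `E_{chunks uniform}[F] ≤ E_{residues uniform}[F] + |Pos| · q / 2^K`.
  Proof (counting, no statistical distance): with `a = ⌊2^K/q⌋`, on the event that every chunk
  is `< a q` (probability `(aq/2^K)^{|Pos|} ≥ 1 - |Pos| q/2^K`, Bernoulli's inequality) the map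
  chunk ↦ residue is exactly `a`-to-`1` in every coordinate (`card_goodFiber`), so that part of the
  expectation is `(a/2^K)^{|Pos|} ∑_v F v ≤ q^{-|Pos|} ∑_v F v`;
* `sum_vector_chunks`: the `L` chunks of width `K` of a uniform string of length `C ≥ L K` form a
  uniform element of `({0,1}^K)^L` (pure reindexing along `finProdFinEquiv`/`finSumFinEquiv`);
* the two combined, for positions numbered by `Pos ≃ Fin L`: `sum_chunkVal_div_le`.

(The symmetric two-sided `(B mod Q)/B` estimate for ONE element is `UniformModQ.lean`; for the
success probability of a reduction the one-sided family version here is what is needed.)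

## References

* M. Naor, O. Reingold, *Number-theoretic constructions of efficient pseudo-random functions*,
  J. ACM 51 (2004), Construction 4.1 (sampling `ℤ_Q` from bits). [cite: NaorReingold2004, Construction 4.1]
* O. Regev, *On lattices, learning with errors, random linear codes, and cryptography*, J. ACM 56
  (2009), §4, proofs of Lemmas 4.1–4.2 (the uniform `t`, `l`). [cite: RegevLWE2009, §4]
-/

namespace Literature.Computability.Cryptography

open Finset Literature.Computability.Complexity

/-! ### Chunks of a coin string -/

/-- The `i`-th chunk of width `K` of the bit string `r`: bits `K i, …, K i + K - 1` (shorter or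
empty past the end of `r`). [cite: NaorReingold2004, Construction 4.1] -/
def chunk (K : ℕ) (r : List Bool) (i : ℕ) : List Bool :=
  (r.drop (K * i)).take K

/-- The element of `ℤ_q` read off the `i`-th chunk: its binary value (least significant bit first,
`bitsToNat`) reduced mod `q`. [cite: NaorReingold2004, Construction 4.1] -/
def chunkVal (K q : ℕ) (r : List Bool) (i : ℕ) : ZMod q :=
  (bitsToNat (chunk K r i) : ZMod q)

/-- A chunk has length `≤ K`. [folklore] -/
theorem length_chunk_le (K : ℕ) (r : List Bool) (i : ℕ) : (chunk K r i).length ≤ K := by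
  unfold chunk
  exact List.length_take_le _ _

/-- Inside the string, a chunk has length exactly `K`. [folklore] -/
theorem length_chunk {K : ℕ} {r : List Bool} {i : ℕ} (h : K * (i + 1) ≤ r.length) :
    (chunk K r i).length = K := by
  unfold chunk
  rw [List.length_take, List.length_drop]
  have : K ≤ r.length - K * i := by rw [mul_add, mul_one] at h; omega
  exact min_eq_left this

/-- The bits of a chunk are the corresponding bits of the string. [folklore] -/
theorem getElem_chunk {K : ℕ} {r : List Bool} {i j : ℕ} (hj : j < (chunk K r i).length) :
    (chunk K r i)[j] = r[K * i + j]'(by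
      have h1 := hj; unfold chunk at h1; rw [List.length_take, List.length_drop] at h1; omega) := by
  unfold chunk
  rw [List.getElem_take, List.getElem_drop]

/-! ### `bitsToNat` on words of a fixed length (injectivity: `FineGrained.BruteForce.bitsToNat_injective_of_length_eq`) -/

/-- The value of a word of length `K`, as an element of `Fin (2^K)`. [folklore] -/
def vecNum {K : ℕ} (w : List.Vector Bool K) : Fin (2 ^ K) :=
  ⟨bitsToNat w.toList, by simpa using bitsToNat_lt w.toList⟩

/-- The value of `vecNum`. [folklore] -/
@[simp] theorem val_vecNum {K : ℕ} (w : List.Vector Bool K) : (vecNum w).val = bitsToNat w.toList := rfl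

/-- `vecNum` is a bijection `{0,1}^K ≃ [0, 2^K)`. [folklore] -/
theorem vecNum_bijective (K : ℕ) : Function.Bijective (vecNum (K := K)) := by
  rw [Fintype.bijective_iff_injective_and_card]
  refine ⟨fun v w h => ?_, by simp [card_vector]⟩
  have h' : bitsToNat v.toList = bitsToNat w.toList := by
    have := congrArg Fin.val h
    simpa using this
  exact List.Vector.eq v w
    (Literature.Computability.FineGrained.BruteForce.bitsToNat_injective_of_length_eq (by simp) h')

/-- Counting words of length `K` by their value is counting numbers below `2^K`. [folklore] -/
theorem card_filter_vec (K : ℕ) (P : ℕ → Prop) [DecidablePred P] :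
    #{w : List.Vector Bool K | P (bitsToNat w.toList)} = #{x ∈ range (2 ^ K) | P x} := by
  rw [← card_filter_fin_eq_card_filter_range]
  refine Finset.card_bij (fun w _ => vecNum w) (fun w hw => ?_) (fun v _ w _ h => (vecNum_bijective K).1 h)
    (fun x hx => ?_)
  · simp only [mem_filter, mem_univ, true_and] at hw ⊢
    exact hw
  · obtain ⟨w, rfl⟩ := (vecNum_bijective K).2 x
    refine ⟨w, ?_, rfl⟩
    simp only [mem_filter, mem_univ, true_and] at hx ⊢
    exact hx

/-! ### The good event: chunks below `a q`, `a = ⌊2^K / q⌋` -/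

section Good

variable {q : ℕ} [NeZero q] (K : ℕ)

omit [NeZero q] in
/-- The number of good words: `#{w ∈ {0,1}^K | value < a q} = a q`, `a = ⌊2^K/q⌋`. [folklore] -/
theorem card_good : #{w : List.Vector Bool K | bitsToNat w.toList < 2 ^ K / q * q} = 2 ^ K / q * q := by
  rw [card_filter_vec K fun x => x < 2 ^ K / q * q]
  have haq : 2 ^ K / q * q ≤ 2 ^ K := Nat.div_mul_le_self _ _
  have : (range (2 ^ K)).filter (fun x => x < 2 ^ K / q * q) = range (2 ^ K / q * q) := by
    ext x
    simp only [mem_filter, mem_range]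
    omega
  rw [this, card_range]

/-- **Good words reduce uniformly**: for every residue `c ∈ ℤ_q` exactly `a = ⌊2^K/q⌋` good words
have value `≡ c`. [folklore] -/
theorem card_goodFiber (c : ZMod q) :
    #{w : List.Vector Bool K | bitsToNat w.toList < 2 ^ K / q * q ∧ (bitsToNat w.toList : ZMod q) = c} =
      2 ^ K / q := by
  have hq : 0 < q := Nat.pos_of_ne_zero (NeZero.ne q)
  set a := 2 ^ K / q with ha
  have haq : a * q ≤ 2 ^ K := Nat.div_mul_le_self _ _
  rw [card_filter_vec K fun x => x < a * q ∧ (x : ZMod q) = c]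
  -- pass to `Fin (a q)` and count residues there
  have h1 : #{x ∈ range (2 ^ K) | x < a * q ∧ (x : ZMod q) = c} = #{x ∈ range (a * q) | x % q = c.val} := by
    congr 1
    ext x
    simp only [mem_filter, mem_range]
    constructor
    · rintro ⟨-, hx, hc⟩
      refine ⟨hx, ?_⟩
      rw [← hc, ZMod.val_natCast]
    · rintro ⟨hx, hc⟩
      refine ⟨lt_of_lt_of_le hx haq, hx, ?_⟩
      rw [← ZMod.natCast_zmod_val c, ← hc]
      exact (ZMod.natCast_mod x q).symm
  rw [h1, ← card_filter_fin_eq_card_filter_range (fun x => x % q = c.val)]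
  have h2 := card_filter_mod_eq (B := a * q) hq ⟨c.val, c.val_lt⟩
  rw [Nat.mul_mod_left, Nat.mul_div_cancel _ hq] at h2
  simpa using h2

end Good

/-! ### The domination estimate -/

/-- Bernoulli: `1 - (1 - d)^L ≤ L d` for `d ≤ 1`. [folklore] -/
theorem one_sub_pow_ge (d : ℝ) (hd1 : d ≤ 1) (L : ℕ) : 1 - (1 - d) ^ L ≤ L * d := by
  have h := one_add_mul_le_pow (a := -d) (by linarith) L
  rw [← sub_eq_add_neg] at h
  linarith

/-- **Domination estimate for a family of chunks.** For positions `Pos` (`|Pos| = L`) and any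
`[0,1]`-valued statistic `F` of the family of residues,
`E_{y uniform in ({0,1}^K)^Pos}[F (residues of y)] ≤ E_{v uniform in ℤ_q^Pos}[F v] + L q / 2^K`:
on the event that all words are good (mass `(aq/2^K)^L ≥ 1 - L q/2^K`) the residues are exactly
uniform, since word ↦ residue is `a`-to-one in every coordinate (`card_goodFiber`), and that part
contributes `(a/2^K)^L ∑_v F v ≤ q^{-L} ∑_v F v`. [cite: NaorReingold2004, Construction 4.1] -/
theorem sum_castVec_div_le {Pos : Type*} [Fintype Pos] [DecidableEq Pos] {q : ℕ} [NeZero q] (K : ℕ)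
    (F : (Pos → ZMod q) → ℝ) (hF0 : ∀ v, 0 ≤ F v) (hF1 : ∀ v, F v ≤ 1) :
    (∑ y : Pos → List.Vector Bool K, F (fun p => (bitsToNat (y p).toList : ZMod q))) /
        (2 ^ K) ^ Fintype.card Pos ≤
      (∑ v : Pos → ZMod q, F v) / q ^ Fintype.card Pos + Fintype.card Pos * q / 2 ^ K := by
  classical
  have hq : 0 < q := Nat.pos_of_ne_zero (NeZero.ne q)
  set L := Fintype.card Pos with hL
  set a := 2 ^ K / q with ha
  have haq : a * q ≤ 2 ^ K := Nat.div_mul_le_self _ _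
  have hmod : 2 ^ K - a * q < q := by
    have h := Nat.div_add_mod' (2 ^ K) q
    have h2 := Nat.mod_lt (2 ^ K) hq
    rw [← ha] at h
    omega
  set Φ : (Pos → List.Vector Bool K) → (Pos → ZMod q) :=
    fun y p => (bitsToNat (y p).toList : ZMod q) with hΦ
  set goodW : Finset (List.Vector Bool K) := univ.filter fun w => bitsToNat w.toList < a * q with hgoodW
  set G : Finset (Pos → List.Vector Bool K) := Fintype.piFinset fun _ => goodW with hG
  -- real constants
  have h2K : (0 : ℝ) < (2 : ℝ) ^ K := by positivity
  have h2KL : (0 : ℝ) < ((2 : ℝ) ^ K) ^ L := by positivity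
  have hqL : (0 : ℝ) < (q : ℝ) ^ L := by positivity
  -- (1) the good part of the sum is `a^L ∑_v F v`
  have hfib : ∀ v : Pos → ZMod q, (G.filter fun y => Φ y = v).card = a ^ L := by
    intro v
    have hset : G.filter (fun y => Φ y = v) =
        Fintype.piFinset fun p => goodW.filter fun w => (bitsToNat w.toList : ZMod q) = v p := by
      ext y
      simp only [hG, hgoodW, mem_filter, Fintype.mem_piFinset, mem_univ, true_and, hΦ, funext_iff]
      exact ⟨fun ⟨h1, h2⟩ p => ⟨h1 p, h2 p⟩, fun h => ⟨fun p => (h p).1, fun p => (h p).2⟩⟩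
    have hp : ∀ p : Pos, (goodW.filter fun w => (bitsToNat w.toList : ZMod q) = v p).card = a := fun p => by
      rw [hgoodW, Finset.filter_filter, ha]
      exact card_goodFiber K (v p)
    rw [hset, Fintype.card_piFinset, Finset.prod_congr rfl fun p _ => hp p, prod_const, card_univ]
  have hgood : ∑ y ∈ G, F (Φ y) = (a : ℝ) ^ L * ∑ v, F v := by
    calc ∑ y ∈ G, F (Φ y) = ∑ y ∈ G, ∑ v, if Φ y = v then F v else 0 := by
          refine Finset.sum_congr rfl fun y _ => ?_
          rw [Finset.sum_ite_eq univ (Φ y) F, if_pos (mem_univ _)]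
      _ = ∑ v, ∑ y ∈ G, if Φ y = v then F v else 0 := Finset.sum_comm
      _ = ∑ v, ((G.filter fun y => Φ y = v).card : ℝ) * F v := by
          refine Finset.sum_congr rfl fun v _ => ?_
          rw [Finset.sum_ite, Finset.sum_const, Finset.sum_const_zero, add_zero, nsmul_eq_mul]
      _ = (a : ℝ) ^ L * ∑ v, F v := by
          rw [Finset.mul_sum]
          refine Finset.sum_congr rfl fun v _ => ?_
          rw [hfib v]
          push_cast
          ring
  -- (2) the bad part is at most the number of bad families
  have hGcard : (G.card : ℝ) = ((a * q : ℕ) : ℝ) ^ L := by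
    rw [hG, Fintype.card_piFinset, prod_const, card_univ, hgoodW, card_good K, ← ha, hL]
    push_cast
    ring
  have hbad : ∑ y ∈ Gᶜ, F (Φ y) ≤ ((2 : ℝ) ^ K) ^ L - ((a * q : ℕ) : ℝ) ^ L := by
    calc ∑ y ∈ Gᶜ, F (Φ y) ≤ ∑ _y ∈ Gᶜ, (1 : ℝ) := Finset.sum_le_sum fun y _ => hF1 _
      _ = (Gᶜ.card : ℝ) := by rw [Finset.sum_const, nsmul_eq_mul, mul_one]
      _ = ((2 : ℝ) ^ K) ^ L - ((a * q : ℕ) : ℝ) ^ L := by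
          rw [Finset.card_compl, Nat.cast_sub (Finset.card_le_univ _), hGcard, Fintype.card_fun,
            card_vector, Fintype.card_bool, ← hL]
          push_cast
          ring
  -- (3) assemble
  have hsplit : ∑ y, F (Φ y) = ∑ y ∈ G, F (Φ y) + ∑ y ∈ Gᶜ, F (Φ y) :=
    (Finset.sum_add_sum_compl G _).symm
  have hsumF : 0 ≤ ∑ v : Pos → ZMod q, F v := Finset.sum_nonneg fun v _ => hF0 v
  -- `(a/2^K)^L ≤ q^{-L}`
  have haq' : ((a : ℝ) ^ L) / ((2 : ℝ) ^ K) ^ L ≤ 1 / (q : ℝ) ^ L := by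
    rw [div_le_div_iff₀ h2KL hqL, one_mul, ← mul_pow]
    refine pow_le_pow_left₀ (by positivity) ?_ L
    exact_mod_cast haq
  -- the bad mass `1 - (aq/2^K)^L ≤ L q / 2^K`
  have hbad' : (((2 : ℝ) ^ K) ^ L - ((a * q : ℕ) : ℝ) ^ L) / ((2 : ℝ) ^ K) ^ L ≤ L * q / (2 : ℝ) ^ K := by
    have hd1 : ((2 ^ K - a * q : ℕ) : ℝ) / (2 : ℝ) ^ K ≤ 1 := by
      rw [div_le_one h2K]
      exact_mod_cast Nat.sub_le _ _
    have hB := one_sub_pow_ge _ hd1 L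
    have hrw : 1 - ((2 ^ K - a * q : ℕ) : ℝ) / (2 : ℝ) ^ K = ((a * q : ℕ) : ℝ) / (2 : ℝ) ^ K := by
      rw [Nat.cast_sub haq, eq_div_iff h2K.ne', sub_mul, div_mul_cancel₀ _ h2K.ne', one_mul]
      push_cast
      ring
    rw [hrw, div_pow] at hB
    have hlt : ((2 ^ K - a * q : ℕ) : ℝ) ≤ q := by exact_mod_cast hmod.le
    calc (((2 : ℝ) ^ K) ^ L - ((a * q : ℕ) : ℝ) ^ L) / ((2 : ℝ) ^ K) ^ L
        = 1 - ((a * q : ℕ) : ℝ) ^ L / ((2 : ℝ) ^ K) ^ L := by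
          rw [sub_div, div_self h2KL.ne']
      _ ≤ L * (((2 ^ K - a * q : ℕ) : ℝ) / (2 : ℝ) ^ K) := hB
      _ ≤ L * q / (2 : ℝ) ^ K := by
          rw [mul_div_assoc]
          exact mul_le_mul_of_nonneg_left (div_le_div_of_nonneg_right hlt h2K.le) (Nat.cast_nonneg _)
  calc (∑ y, F (Φ y)) / ((2 : ℝ) ^ K) ^ L
      = ((a : ℝ) ^ L) / ((2 : ℝ) ^ K) ^ L * ∑ v, F v + (∑ y ∈ Gᶜ, F (Φ y)) / ((2 : ℝ) ^ K) ^ L := by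
        rw [hsplit, hgood, add_div, mul_div_right_comm]
    _ ≤ 1 / (q : ℝ) ^ L * ∑ v, F v + (((2 : ℝ) ^ K) ^ L - ((a * q : ℕ) : ℝ) ^ L) / ((2 : ℝ) ^ K) ^ L :=
        add_le_add (mul_le_mul_of_nonneg_right haq' hsumF) (div_le_div_of_nonneg_right hbad h2KL.le)
    _ ≤ (∑ v, F v) / (q : ℝ) ^ L + L * q / (2 : ℝ) ^ K := by
        rw [one_div_mul_eq_div]
        exact add_le_add le_rfl hbad'

/-! ### The chunks of a uniform string are uniform words -/

/-- Splitting off the first `K` bits: `{0,1}^C ≃ {0,1}^K × {0,1}^{C-K}` for `K ≤ C`. [folklore] -/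
def vecSplit (K C : ℕ) (h : K ≤ C) : List.Vector Bool C ≃ List.Vector Bool K × List.Vector Bool (C - K) where
  toFun r := (⟨r.toList.take K, by simp [h]⟩, ⟨r.toList.drop K, by simp⟩)
  invFun p := ⟨p.1.toList ++ p.2.toList, by simp [h]⟩
  left_inv r := List.Vector.eq _ _ (by simp)
  right_inv p := by
    obtain ⟨v, w⟩ := p
    refine Prod.ext (List.Vector.eq _ _ ?_) (List.Vector.eq _ _ ?_)
    · simp
    · simp

/-- The family of the first `L` chunks of width `K` of a vector of length `C ≥ K L`, as words of
length `K`. [folklore] -/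
def chunks (K L : ℕ) {C : ℕ} (hC : K * L ≤ C) (r : List.Vector Bool C) : Fin L → List.Vector Bool K :=
  fun i => ⟨chunk K r.toList i, length_chunk (by
    rw [List.Vector.toList_length]
    exact (Nat.mul_le_mul_left K i.isLt).trans hC)⟩

/-- The bits of `chunks`. [folklore] -/
@[simp] theorem toList_chunks (K L : ℕ) {C : ℕ} (hC : K * L ≤ C) (r : List.Vector Bool C) (i : Fin L) :
    (chunks K L hC r i).toList = chunk K r.toList i := rfl

/-- Chunk `0` is the first `K` bits. [folklore] -/
theorem chunk_zero (K : ℕ) (r : List Bool) : chunk K r 0 = r.take K := by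
  simp [chunk]

/-- Chunk `i + 1` is chunk `i` of the string with the first `K` bits dropped. [folklore] -/
theorem chunk_succ (K : ℕ) (r : List Bool) (i : ℕ) : chunk K r (i + 1) = chunk K (r.drop K) i := by
  simp only [chunk, List.drop_drop]
  congr 2
  ring

/-- The chunks of `r` are: the first `K` bits, then the chunks of the rest. [folklore] -/
theorem chunks_succ (K L : ℕ) {C : ℕ} (hC : K * (L + 1) ≤ C) (r : List.Vector Bool C) :
    chunks K (L + 1) hC r =
      Fin.cons (vecSplit K C ((Nat.le_mul_of_pos_right K L.succ_pos).trans hC) r).1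
        (chunks K L (by rw [Nat.mul_succ] at hC; omega)
          (vecSplit K C ((Nat.le_mul_of_pos_right K L.succ_pos).trans hC) r).2) := by
  funext i
  refine Fin.cases ?_ (fun i => ?_) i
  · apply List.Vector.eq
    simp [vecSplit, chunk_zero]
  · apply List.Vector.eq
    simp [vecSplit, chunk_succ]

/-- **Uniform chunks**: summing a function of the first `L` chunks over all strings of length
`C ≥ K L` gives `2^{C - KL}` times its sum over all families of words — the chunks of a uniform
string are independent uniform words. [folklore] -/
theorem sum_vector_chunks (K : ℕ) {M : Type*} [AddCommMonoid M] :
    ∀ (L : ℕ) {C : ℕ} (hC : K * L ≤ C) (g : (Fin L → List.Vector Bool K) → M),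
      ∑ r : List.Vector Bool C, g (chunks K L hC r) = (2 ^ (C - K * L)) • ∑ y : Fin L → List.Vector Bool K, g y
  | 0, C, hC, g => by
    set a₀ : Fin 0 → List.Vector Bool K := fun i => Fin.elim0 i with ha₀
    have h1 : ∀ r : List.Vector Bool C, g (chunks K 0 hC r) = g a₀ := fun r => by
      rw [Subsingleton.elim (chunks K 0 hC r) a₀]
    rw [Finset.sum_congr rfl fun r _ => h1 r, Finset.sum_const, Finset.card_univ, card_vector,
      Fintype.card_bool, Fintype.sum_subsingleton _ a₀, Nat.mul_zero, Nat.sub_zero]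
  | L + 1, C, hC, g => by
    have hK : K ≤ C := (Nat.le_mul_of_pos_right K L.succ_pos).trans hC
    have hC' : K * L ≤ C - K := by rw [Nat.mul_succ] at hC; omega
    have hexp : C - K - K * L = C - K * (L + 1) := by rw [Nat.mul_succ]; omega
    calc ∑ r : List.Vector Bool C, g (chunks K (L + 1) hC r)
        = ∑ r : List.Vector Bool C,
            g (Fin.cons (vecSplit K C hK r).1 (chunks K L hC' (vecSplit K C hK r).2)) :=
          Finset.sum_congr rfl fun r _ => by rw [chunks_succ K L hC r]
      _ = ∑ p : List.Vector Bool K × List.Vector Bool (C - K), g (Fin.cons p.1 (chunks K L hC' p.2)) :=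
          Fintype.sum_equiv (vecSplit K C hK) _ _ fun r => rfl
      _ = ∑ w : List.Vector Bool K, ∑ r' : List.Vector Bool (C - K), g (Fin.cons w (chunks K L hC' r')) :=
          Fintype.sum_prod_type _
      _ = ∑ w : List.Vector Bool K, (2 ^ (C - K - K * L)) • ∑ y : Fin L → List.Vector Bool K, g (Fin.cons w y) :=
          Finset.sum_congr rfl fun w _ => sum_vector_chunks K L hC' fun y => g (Fin.cons w y)
      _ = (2 ^ (C - K - K * L)) • ∑ p : List.Vector Bool K × (Fin L → List.Vector Bool K), g (Fin.cons p.1 p.2) := by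
          rw [← Finset.smul_sum, Fintype.sum_prod_type]
      _ = (2 ^ (C - K * (L + 1))) • ∑ y : Fin (L + 1) → List.Vector Bool K, g y := by
          rw [hexp]
          congr 1
          exact Fintype.sum_equiv (Fin.consEquiv fun _ : Fin (L + 1) => List.Vector Bool K)
            (fun p => g (Fin.cons p.1 p.2)) g fun p => rfl

/-- **Reading residues off a uniform coin string.** Positions `Pos ≃ Fin L` are read from the
chunks of a uniform string of length `C ≥ K L` (position `p` from chunk `e p`); for any
`[0,1]`-valued statistic `F`, `E_r[F (residues r)] ≤ E_{v uniform}[F v] + L q / 2^K`.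
[cite: NaorReingold2004, Construction 4.1] -/
theorem sum_chunkVal_div_le {Pos : Type*} [Fintype Pos] [DecidableEq Pos] {q : ℕ} [NeZero q] {K L C : ℕ}
    (e : Pos ≃ Fin L) (hC : K * L ≤ C) (F : (Pos → ZMod q) → ℝ) (hF0 : ∀ v, 0 ≤ F v)
    (hF1 : ∀ v, F v ≤ 1) :
    (∑ r : List.Vector Bool C, F (fun p => chunkVal K q r.toList (e p))) / 2 ^ C ≤
      (∑ v : Pos → ZMod q, F v) / q ^ Fintype.card Pos + L * q / 2 ^ K := by
  classical
  have hL : Fintype.card Pos = L := by simpa using Fintype.card_congr e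
  -- the statistic as a function of the family of chunks indexed by `Fin L`
  set g : (Fin L → List.Vector Bool K) → ℝ := fun y => F fun p => (bitsToNat (y (e p)).toList : ZMod q)
    with hg
  have hchunks : ∀ r : List.Vector Bool C,
      F (fun p => chunkVal K q r.toList (e p)) = g (chunks K L hC r) := fun r => rfl
  have hsum : ∑ r : List.Vector Bool C, F (fun p => chunkVal K q r.toList (e p)) =
      (2 : ℝ) ^ (C - K * L) * ∑ y : Fin L → List.Vector Bool K, g y := by
    rw [Finset.sum_congr rfl fun r _ => hchunks r, sum_vector_chunks K L hC g, nsmul_eq_mul]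
    push_cast
    ring
  -- reindex families along `e`
  have hre : ∑ y : Fin L → List.Vector Bool K, g y =
      ∑ y : Pos → List.Vector Bool K, F (fun p => (bitsToNat (y p).toList : ZMod q)) := by
    refine Fintype.sum_equiv (Equiv.arrowCongr e.symm (Equiv.refl _)) _ _ fun y => ?_
    simp [hg, Equiv.arrowCongr_apply]
  have hmain := sum_castVec_div_le K F hF0 hF1
  rw [hL] at hmain
  rw [hL]
  have h2C : (2 : ℝ) ^ C = (2 : ℝ) ^ (C - K * L) * ((2 : ℝ) ^ K) ^ L := by
    rw [← pow_mul, ← pow_add]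
    congr 1
    omega
  rw [hsum, hre, h2C, mul_div_mul_left _ _ (by positivity)]
  exact hmain

end Literature.Computability.Cryptography
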